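import Literature.MathematicalPhysics.QuantumLattice.OverlapLocality
import HarnessLib

/-!
# Plaquette bounds on the commutators of the twisted shifts (Hernández–Jansen–Lüscher 1999, App. C)

Topic `Literature/MathematicalPhysics/QuantumLattice`; namespace
`Literature.MathematicalPhysics.QuantumLattice`.

Source: P. Hernández, K. Jansen, M. Lüscher, *Locality properties of Neuberger's lattice Dirac
operator*, Nucl. Phys. B 552 (1999) 363–378, arXiv:hep-lat/9808010, Appendix C, eqs. (C.5)–(C.6)
[HernandezJansenLuscher1999].  Printed there (lattice spacing `a`, unitary link variables `U(x,μ)`,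
covariant differences `∇_μψ(x) = a⁻¹[U(x,μ)ψ(x+aμ̂) − ψ(x)]`,
`∇*_μψ(x) = a⁻¹[ψ(x) − U(x−aμ̂,μ)⁻¹ψ(x−aμ̂)]` of App. A):
"`a²[∇_μ,∇_ν]ψ(x) = {U(x,μ)U(x+aμ̂,ν) − U(x,ν)U(x+aν̂,μ)}ψ(x+aμ̂+aν̂)`" (C.5); the curly bracket
"is equal to a unitary matrix times `1 − U(p)` where `U(p)` denotes the product of the link
variables around the associated plaquette `p`"; hence the bound (2.15), `‖1 − U(p)‖ ≤ ε` for all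
plaquettes `p`, "implies `‖a²[∇_μ,∇_ν]‖ ≤ ε`" (C.6) "and the same bound is also obtained if one or
both of the forward difference operators are replaced by backward ones".

## How it is stated here

Lattice units, the periodic lattice `(ℤ/Lℤ)⁴` (`L ≥ 1`), a gauge field `U : GaugeConfig 4 L G`
read through a unitary representation `ρ : G →* Matrix (Fin N) (Fin N) ℂ`, and the `U`-twisted
forward shift `F_μ = linkHop ρ U μ` on site ⊗ colour space of `OverlapLocality.lean`
(`(F_μψ)(x) = ρ(U(x,μ))ψ(x+μ̂)`, i.e. `1 + ∇_μ`; its conjugate transpose is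
`(F_μᴴψ)(x) = ρ(U(x−μ̂,μ))ᴴψ(x−μ̂)`, i.e. `1 − ∇*_μ`).  Since `[∇_μ,∇_ν] = [F_μ,F_ν]`,
`[∇_μ,∇*_ν] = −[F_μ,F_νᴴ]` and `[∇*_μ,∇*_ν] = [F_μᴴ,F_νᴴ]`, the three printed bounds are the three
conjuncts of `hjl_commutator_bounds`, written (HJL's footnote to (2.1): operator inequalities are
inequalities of expectation values) as inequalities of quadratic forms,
`Σ_i ‖([F_μ,F_ν]φ)_i‖² ≤ ε² Σ_i ‖φ_i‖²` etc., for `μ ≠ ν` and an admissible field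
(`IsNormAdmissible ρ U ε`; "the matrix norm in colour space" is Mathlib's `ℓ²` operator norm,
`open scoped Matrix.Norms.L2Operator`).

Proof (HJL's sentence, made explicit).  Each of the three operators `K` is supported on a single
translate of the torus: `(Kφ)(z + d) = (ρ(a_z) − ρ(b_z)) φ(z + c)` for fixed lattice vectors
`c, d` and link products `a_z, b_z ∈ G` with `a_z b_z⁻¹` conjugate in `G` to the holonomy `U(p)` of
the plaquette at `z` in the `(μ,ν)` or the `(ν,μ)` orientation (`linkHop_mulVec`,
`conjTranspose_linkHop_mulVec`); for unitary `ρ`,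
`‖ρ(a) − ρ(b)‖ ≤ ‖1 − ρ(ab⁻¹)‖·‖ρ(b)‖ ≤ ‖1 − ρ(U(p))‖ ≤ ε` (`norm_rep_sub_rep_le_of_conj`); and
summing `‖(ρ(a_z) − ρ(b_z))φ(z+c)‖² ≤ ε²‖φ(z+c)‖²` over `z` gives the claim after re-indexing the
torus by the two translations (`sum_norm_sq_le_of_twistedShift`).  Admissibility only quantifies
the ordered planes `μ < ν`; the reversed orientation is the inverse holonomy, which is as close to
`1` for unitary `ρ` (`norm_one_sub_rep_plaquetteHolonomy_le`).

Not here: the identity (C.3)–(C.4) for `A†A` and the assembly of the gap bound (2.16).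

## References

* P. Hernández, K. Jansen, M. Lüscher, *Locality properties of Neuberger's lattice Dirac
  operator*, Nucl. Phys. B 552 (1999) 363–378, arXiv:hep-lat/9808010, App. A and App. C
  (C.5)–(C.6). [HernandezJansenLuscher1999]
-/

noncomputable section

open Matrix Finset
open scoped Matrix.Norms.L2Operator
open Literature.Probability.LatticeModels (TorusSite)
open Literature.MathematicalPhysics.QuantumFieldTheory

namespace Literature.MathematicalPhysics.QuantumLattice

section Helpers

variable {L N : ℕ} {G : Type*} [Group G] (ρ : G →* Matrix (Fin N) (Fin N) ℂ)

/-! ### Colour-space norm estimates for a unitary representation -/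

/-- `‖ρ(g)‖ ≤ 1` in the `ℓ²` operator norm for a representation by unitary matrices
(`‖ρ(g)‖² = ‖ρ(g)ᴴρ(g)‖ = ‖1‖ ≤ 1`). [folklore] -/
theorem l2_opNorm_rep_le_one (hρ : ∀ g, ρ g ∈ Matrix.unitaryGroup (Fin N) ℂ) (g : G) :
    ‖ρ g‖ ≤ 1 := by
  have hone : ‖(1 : Matrix (Fin N) (Fin N) ℂ)‖ ≤ 1 := by
    rw [Matrix.cstar_norm_def, map_one]
    exact ContinuousLinearMap.norm_id_le
  have hsq : ‖ρ g‖ * ‖ρ g‖ ≤ 1 := by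
    rw [← CStarRing.norm_star_mul_self, Matrix.mem_unitaryGroup_iff'.mp (hρ g)]
    exact hone
  nlinarith [norm_nonneg (ρ g)]

/-- `‖1 − ρ(g⁻¹)‖ = ‖1 − ρ(g)‖` for a representation by unitary matrices
(`1 − ρ(g⁻¹) = (1 − ρ(g))ᴴ`, `star_rep_eq_rep_inv`). [folklore] -/
theorem norm_one_sub_rep_inv (hρ : ∀ g, ρ g ∈ Matrix.unitaryGroup (Fin N) ℂ) (g : G) :
    ‖(1 : Matrix (Fin N) (Fin N) ℂ) - ρ g⁻¹‖ = ‖(1 : Matrix (Fin N) (Fin N) ℂ) - ρ g‖ := by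
  rw [← star_rep_eq_rep_inv ρ hρ, star_eq_conjTranspose,
    ← l2_opNorm_conjTranspose ((1 : Matrix (Fin N) (Fin N) ℂ) - ρ g), conjTranspose_sub,
    conjTranspose_one]

/-- Conjugation does not increase the distance to `1`: `‖1 − ρ(hgh⁻¹)‖ ≤ ‖1 − ρ(g)‖` for a
representation by unitary matrices (`1 − ρ(hgh⁻¹) = ρ(h)(1 − ρ(g))ρ(h⁻¹)`). [folklore] -/
theorem norm_one_sub_rep_conj_le (hρ : ∀ g, ρ g ∈ Matrix.unitaryGroup (Fin N) ℂ) (h g : G) :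
    ‖(1 : Matrix (Fin N) (Fin N) ℂ) - ρ (h * g * h⁻¹)‖ ≤
      ‖(1 : Matrix (Fin N) (Fin N) ℂ) - ρ g‖ := by
  have hconj : (1 : Matrix (Fin N) (Fin N) ℂ) - ρ (h * g * h⁻¹) = ρ h * (1 - ρ g) * ρ h⁻¹ := by
    rw [mul_sub, mul_one, sub_mul, ← map_mul, ← map_mul, ← map_mul, mul_inv_cancel, map_one]
  rw [hconj]
  calc ‖ρ h * (1 - ρ g) * ρ h⁻¹‖ ≤ ‖ρ h‖ * ‖(1 : Matrix (Fin N) (Fin N) ℂ) - ρ g‖ * ‖ρ h⁻¹‖ :=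
        norm_mul₃_le
    _ ≤ 1 * ‖(1 : Matrix (Fin N) (Fin N) ℂ) - ρ g‖ * 1 := by
        gcongr
        · exact l2_opNorm_rep_le_one ρ hρ h
        · exact l2_opNorm_rep_le_one ρ hρ h⁻¹
    _ = ‖(1 : Matrix (Fin N) (Fin N) ℂ) - ρ g‖ := by ring

/-- `‖ρ(a) − ρ(b)‖ ≤ ‖1 − ρ(ab⁻¹)‖` for a representation by unitary matrices:
`ρ(a) − ρ(b) = (ρ(ab⁻¹) − 1)ρ(b)` is "a unitary matrix times `1 − U(p)`" up to sign. [folklore] -/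
theorem norm_rep_sub_rep_le (hρ : ∀ g, ρ g ∈ Matrix.unitaryGroup (Fin N) ℂ) (a b : G) :
    ‖ρ a - ρ b‖ ≤ ‖(1 : Matrix (Fin N) (Fin N) ℂ) - ρ (a * b⁻¹)‖ := by
  have hab : ρ a - ρ b = (ρ (a * b⁻¹) - 1) * ρ b := by
    rw [sub_mul, one_mul, ← map_mul, inv_mul_cancel_right]
  rw [hab]
  calc ‖(ρ (a * b⁻¹) - 1) * ρ b‖ ≤ ‖ρ (a * b⁻¹) - 1‖ * ‖ρ b‖ := norm_mul_le _ _
    _ ≤ ‖ρ (a * b⁻¹) - 1‖ * 1 := by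
        gcongr
        exact l2_opNorm_rep_le_one ρ hρ b
    _ = ‖(1 : Matrix (Fin N) (Fin N) ℂ) - ρ (a * b⁻¹)‖ := by rw [mul_one, norm_sub_rev]

/-! ### Admissibility in either orientation -/

/-- **Admissibility bounds both orientations**: `‖1 − ρ(U(p))‖ ≤ ε` for the plaquette at `x` in the
`(μ, ν)` plane, `μ ≠ ν` in either order (`IsNormAdmissible` quantifies `μ < ν`; the reversed
orientation is the inverse holonomy, as close to `1` for unitary `ρ`). [folklore] -/
theorem norm_one_sub_rep_plaquetteHolonomy_le (hρ : ∀ g, ρ g ∈ Matrix.unitaryGroup (Fin N) ℂ)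
    {U : GaugeConfig 4 L G} {ε : ℝ} (hU : IsNormAdmissible ρ U ε) (x : TorusSite 4 L)
    {μ ν : Fin 4} (hμν : μ ≠ ν) :
    ‖(1 : Matrix (Fin N) (Fin N) ℂ) - ρ (plaquetteHolonomy U x μ ν)‖ ≤ ε := by
  rcases lt_or_gt_of_ne hμν with h | h
  · exact hU (x, ⟨(μ, ν), h⟩)
  · have hinv : plaquetteHolonomy U x μ ν = (plaquetteHolonomy U x ν μ)⁻¹ := by
      simp only [plaquetteHolonomy, _root_.mul_inv_rev, inv_inv, mul_assoc]
    rw [hinv, norm_one_sub_rep_inv ρ hρ]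
    exact hU (x, ⟨(ν, μ), h⟩)

/-- **HJL's plaquette estimate** (App. C, after (C.6): the bracket is "a unitary matrix times
`1 − U(p)`"): if `ab⁻¹` is conjugate in `G` to the holonomy of a plaquette, then
`‖ρ(a) − ρ(b)‖ ≤ ε` for an admissible field and unitary `ρ`.
[cite: HernandezJansenLuscher1999, App. C (C.5)–(C.6)] -/
theorem norm_rep_sub_rep_le_of_conj (hρ : ∀ g, ρ g ∈ Matrix.unitaryGroup (Fin N) ℂ)
    {U : GaugeConfig 4 L G} {ε : ℝ} (hU : IsNormAdmissible ρ U ε) (x : TorusSite 4 L)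
    {μ ν : Fin 4} (hμν : μ ≠ ν) (h a b : G)
    (hab : a * b⁻¹ = h * plaquetteHolonomy U x μ ν * h⁻¹) : ‖ρ a - ρ b‖ ≤ ε := by
  refine (norm_rep_sub_rep_le ρ hρ a b).trans ?_
  rw [hab]
  exact (norm_one_sub_rep_conj_le ρ hρ h _).trans
    (norm_one_sub_rep_plaquetteHolonomy_le ρ hρ hU x hμν)

/-! ### Quadratic forms -/

omit [Group G] in
/-- The operator-norm bound in quadratic-form language on any finite index type:
`Σ_i ‖(Mψ)_i‖² ≤ ‖M‖² Σ_i ‖ψ_i‖²` (`ℓ²` operator norm). [folklore] -/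
theorem sum_norm_sq_mulVec_le' {n : Type*} [Fintype n] [DecidableEq n] (M : Matrix n n ℂ)
    (ψ : n → ℂ) : ∑ i, ‖(M *ᵥ ψ) i‖ ^ 2 ≤ ‖M‖ ^ 2 * ∑ i, ‖ψ i‖ ^ 2 := by
  set e := EuclideanSpace.equiv n ℂ
  have hψ : ∑ i, ‖ψ i‖ ^ 2 = ‖e.symm ψ‖ ^ 2 := by
    rw [EuclideanSpace.norm_sq_eq]; rfl
  have hMψ : ∑ i, ‖(M *ᵥ ψ) i‖ ^ 2 = ‖e.symm (M *ᵥ ⇑(e.symm ψ))‖ ^ 2 := by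
    rw [EuclideanSpace.norm_sq_eq]; rfl
  rw [hψ, hMψ, ← mul_pow]
  exact pow_le_pow_left₀ (norm_nonneg _) (Matrix.l2_opNorm_mulVec M _) 2

variable [NeZero L]

/-- **Block estimate for an operator supported on one translate of the torus.**  If
`v(z + d) = (A_z − B_z) φ(z + c)` site by site, with colour matrices `‖A_z − B_z‖ ≤ ε`, then
`Σ_i ‖v_i‖² ≤ ε² Σ_i ‖φ_i‖²` (sum the blockwise operator-norm bound over `z` and re-index the
torus by the translations `z ↦ z + d`, `z ↦ z + c`). [folklore] -/
theorem sum_norm_sq_le_of_twistedShift (A B : TorusSite 4 L → Matrix (Fin N) (Fin N) ℂ)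
    (c d : TorusSite 4 L) {ε : ℝ} (hAB : ∀ z, ‖A z - B z‖ ≤ ε) (φ v : TorusSite 4 L × Fin N → ℂ)
    (hv : ∀ z a, v (z + d, a) =
      (A z *ᵥ fun b => φ (z + c, b)) a - (B z *ᵥ fun b => φ (z + c, b)) a) :
    ∑ i, ‖v i‖ ^ 2 ≤ ε ^ 2 * ∑ i, ‖φ i‖ ^ 2 := by
  have hL : ∑ i, ‖v i‖ ^ 2 = ∑ z, ∑ a, ‖v (z + d, a)‖ ^ 2 := by
    rw [Fintype.sum_prod_type]
    exact (Fintype.sum_equiv (Equiv.addRight d) (fun z => ∑ a, ‖v (z + d, a)‖ ^ 2)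
      (fun x => ∑ a, ‖v (x, a)‖ ^ 2) fun z => rfl).symm
  have hR : ∑ i, ‖φ i‖ ^ 2 = ∑ z, ∑ b, ‖φ (z + c, b)‖ ^ 2 := by
    rw [Fintype.sum_prod_type]
    exact (Fintype.sum_equiv (Equiv.addRight c) (fun z => ∑ b, ‖φ (z + c, b)‖ ^ 2)
      (fun x => ∑ b, ‖φ (x, b)‖ ^ 2) fun z => rfl).symm
  rw [hL, hR, Finset.mul_sum]
  refine Finset.sum_le_sum fun z _ => ?_
  have hv' : ∀ a, v (z + d, a) = ((A z - B z) *ᵥ fun b => φ (z + c, b)) a := fun a => by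
    rw [hv, Matrix.sub_mulVec, Pi.sub_apply]
  simp_rw [hv']
  refine (sum_norm_sq_mulVec_le' (A z - B z) fun b => φ (z + c, b)).trans ?_
  have h0 : 0 ≤ ∑ b, ‖φ (z + c, b)‖ ^ 2 := Finset.sum_nonneg fun _ _ => by positivity
  exact mul_le_mul_of_nonneg_right (pow_le_pow_left₀ (norm_nonneg _) (hAB z) 2) h0

/-! ### The twisted shifts on vectors -/

/-- **The twisted shift on vectors**: `(F_μψ)(x) = ρ(U(x,μ)) ψ(x + μ̂)` (HJL's `(1 + a∇_μ)ψ`).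
[folklore] -/
theorem linkHop_mulVec (U : GaugeConfig 4 L G) (μ : Fin 4) (ψ : TorusSite 4 L × Fin N → ℂ)
    (x : TorusSite 4 L) (a : Fin N) :
    (linkHop ρ U μ *ᵥ ψ) (x, a) = (ρ (U (x, μ)) *ᵥ fun b => ψ (x + Pi.single μ 1, b)) a := by
  simp only [Matrix.mulVec, dotProduct, linkHop, Matrix.of_apply, Fintype.sum_prod_type, ite_mul,
    zero_mul, Finset.sum_ite_irrel, Finset.sum_const_zero, Finset.sum_ite_eq', Finset.mem_univ,
    if_true, Site.shift]

/-- **The adjoint shift on vectors**: `(F_μᴴψ)(x) = ρ(U(x − μ̂,μ))ᴴ ψ(x − μ̂)`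
(HJL's `(1 − a∇*_μ)ψ`, `ρ(U)ᴴ = ρ(U⁻¹)`). [folklore] -/
theorem conjTranspose_linkHop_mulVec (U : GaugeConfig 4 L G) (μ : Fin 4)
    (ψ : TorusSite 4 L × Fin N → ℂ) (x : TorusSite 4 L) (a : Fin N) :
    ((linkHop ρ U μ)ᴴ *ᵥ ψ) (x, a) =
      ((ρ (U (x - Pi.single μ 1, μ)))ᴴ *ᵥ fun b => ψ (x - Pi.single μ 1, b)) a := by
  simp only [Matrix.mulVec, dotProduct, conjTranspose_apply, linkHop, Matrix.of_apply,
    Fintype.sum_prod_type, eq_shift_iff, star_ite_zero, ite_mul, zero_mul, Finset.sum_ite_irrel,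
    Finset.sum_const_zero, Finset.sum_ite_eq', Finset.mem_univ, if_true]

/-! ### The three commutator bounds -/

/-- **(C.6), two forward differences**: `‖[∇_μ,∇_ν]‖ ≤ ε`, i.e.
`Σ_i ‖((F_μF_ν − F_νF_μ)φ)_i‖² ≤ ε² Σ_i ‖φ_i‖²` for an admissible field, unitary `ρ` and `μ ≠ ν`
((C.5): `([F_μ,F_ν]φ)(x) = {ρ(U(x,μ)U(x+μ̂,ν)) − ρ(U(x,ν)U(x+ν̂,μ))}φ(x+μ̂+ν̂)`, and
`U(x,μ)U(x+μ̂,ν)·(U(x,ν)U(x+ν̂,μ))⁻¹ = U(p)`).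
[cite: HernandezJansenLuscher1999, App. C (C.5)–(C.6)] -/
theorem sum_norm_sq_linkHop_comm_mulVec_le (hρ : ∀ g, ρ g ∈ Matrix.unitaryGroup (Fin N) ℂ)
    {U : GaugeConfig 4 L G} {ε : ℝ} (hU : IsNormAdmissible ρ U ε) {μ ν : Fin 4} (hμν : μ ≠ ν)
    (φ : TorusSite 4 L × Fin N → ℂ) :
    ∑ i, ‖((linkHop ρ U μ * linkHop ρ U ν - linkHop ρ U ν * linkHop ρ U μ) *ᵥ φ) i‖ ^ 2 ≤
      ε ^ 2 * ∑ i, ‖φ i‖ ^ 2 := by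
  refine sum_norm_sq_le_of_twistedShift
    (fun z => ρ (U (z, μ) * U (z + Pi.single μ 1, ν)))
    (fun z => ρ (U (z, ν) * U (z + Pi.single ν 1, μ)))
    (Pi.single μ 1 + Pi.single ν 1) 0 (fun z => ?_) φ _ (fun z a => ?_)
  · exact norm_rep_sub_rep_le_of_conj ρ hρ hU z hμν 1 _ _ (by
      simp only [plaquetteHolonomy, Site.shift]; group)
  · have h1 : z + Pi.single ν (1 : ZMod L) + Pi.single μ 1 = z + Pi.single μ 1 + Pi.single ν 1 :=
      add_right_comm _ _ _
    have h2 : z + (Pi.single μ (1 : ZMod L) + Pi.single ν 1) = z + Pi.single μ 1 + Pi.single ν 1 :=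
      (add_assoc _ _ _).symm
    simp only [add_zero, Matrix.sub_mulVec, Pi.sub_apply, ← Matrix.mulVec_mulVec, map_mul,
      linkHop_mulVec, h1, h2]

/-- **(C.6), one forward and one backward difference**: `‖[∇_μ,∇*_ν]‖ ≤ ε`, i.e.
`Σ_i ‖((F_μF_νᴴ − F_νᴴF_μ)φ)_i‖² ≤ ε² Σ_i ‖φ_i‖²` for an admissible field, unitary `ρ` and `μ ≠ ν`
(at `x = z + ν̂` the bracket is `ρ(U(z+ν̂,μ))ρ(U(z+μ̂,ν))ᴴ − ρ(U(z,ν))ᴴρ(U(z,μ))`, acting on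
`φ(z+μ̂)`, and `U(z+ν̂,μ)U(z+μ̂,ν)⁻¹·(U(z,ν)⁻¹U(z,μ))⁻¹ = U(z,ν)⁻¹ U(p)_{νμ} U(z,ν)`).
[cite: HernandezJansenLuscher1999, App. C (C.5)–(C.6)] -/
theorem sum_norm_sq_linkHop_comm_conjTranspose_mulVec_le
    (hρ : ∀ g, ρ g ∈ Matrix.unitaryGroup (Fin N) ℂ)
    {U : GaugeConfig 4 L G} {ε : ℝ} (hU : IsNormAdmissible ρ U ε) {μ ν : Fin 4} (hμν : μ ≠ ν)
    (φ : TorusSite 4 L × Fin N → ℂ) :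
    ∑ i, ‖((linkHop ρ U μ * (linkHop ρ U ν)ᴴ - (linkHop ρ U ν)ᴴ * linkHop ρ U μ) *ᵥ φ) i‖ ^ 2 ≤
      ε ^ 2 * ∑ i, ‖φ i‖ ^ 2 := by
  refine sum_norm_sq_le_of_twistedShift
    (fun z => ρ (U (z + Pi.single ν 1, μ)) * (ρ (U (z + Pi.single μ 1, ν)))ᴴ)
    (fun z => (ρ (U (z, ν)))ᴴ * ρ (U (z, μ)))
    (Pi.single μ 1) (Pi.single ν 1) (fun z => ?_) φ _ (fun z a => ?_)
  · simp only [← star_eq_conjTranspose, star_rep_eq_rep_inv ρ hρ, ← map_mul]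
    exact norm_rep_sub_rep_le_of_conj ρ hρ hU z hμν.symm (U (z, ν))⁻¹ _ _ (by
      simp only [plaquetteHolonomy, Site.shift]; group)
  · have h1 : z + Pi.single ν (1 : ZMod L) + Pi.single μ 1 - Pi.single ν 1 = z + Pi.single μ 1 := by
      abel
    have h2 : z + Pi.single ν (1 : ZMod L) - Pi.single ν 1 = z := by abel
    simp only [Matrix.sub_mulVec, Pi.sub_apply, ← Matrix.mulVec_mulVec, linkHop_mulVec,
      conjTranspose_linkHop_mulVec, h1, h2]

/-- **(C.6), two backward differences**: `‖[∇*_μ,∇*_ν]‖ ≤ ε`, i.e.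
`Σ_i ‖((F_μᴴF_νᴴ − F_νᴴF_μᴴ)φ)_i‖² ≤ ε² Σ_i ‖φ_i‖²` for an admissible field, unitary `ρ` and
`μ ≠ ν` (at `x = z + μ̂ + ν̂` the bracket is `ρ(U(z+ν̂,μ))ᴴρ(U(z,ν))ᴴ − ρ(U(z+μ̂,ν))ᴴρ(U(z,μ))ᴴ`,
acting on `φ(z)`, and `ab⁻¹ = h U(p) h⁻¹` with `h = (U(z,ν)U(z+ν̂,μ))⁻¹`).
[cite: HernandezJansenLuscher1999, App. C (C.5)–(C.6)] -/
theorem sum_norm_sq_conjTranspose_linkHop_comm_mulVec_le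
    (hρ : ∀ g, ρ g ∈ Matrix.unitaryGroup (Fin N) ℂ)
    {U : GaugeConfig 4 L G} {ε : ℝ} (hU : IsNormAdmissible ρ U ε) {μ ν : Fin 4} (hμν : μ ≠ ν)
    (φ : TorusSite 4 L × Fin N → ℂ) :
    ∑ i, ‖(((linkHop ρ U μ)ᴴ * (linkHop ρ U ν)ᴴ - (linkHop ρ U ν)ᴴ * (linkHop ρ U μ)ᴴ) *ᵥ φ) i‖ ^ 2
      ≤ ε ^ 2 * ∑ i, ‖φ i‖ ^ 2 := by
  refine sum_norm_sq_le_of_twistedShift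
    (fun z => (ρ (U (z + Pi.single ν 1, μ)))ᴴ * (ρ (U (z, ν)))ᴴ)
    (fun z => (ρ (U (z + Pi.single μ 1, ν)))ᴴ * (ρ (U (z, μ)))ᴴ)
    0 (Pi.single μ 1 + Pi.single ν 1) (fun z => ?_) φ _ (fun z a => ?_)
  · simp only [← star_eq_conjTranspose, star_rep_eq_rep_inv ρ hρ, ← map_mul]
    exact norm_rep_sub_rep_le_of_conj ρ hρ hU z hμν (U (z, ν) * U (z + Pi.single ν 1, μ))⁻¹ _ _
      (by simp only [plaquetteHolonomy, Site.shift]; group)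
  · have h1 : z + (Pi.single μ (1 : ZMod L) + Pi.single ν 1) - Pi.single μ 1 =
        z + Pi.single ν 1 := by abel
    have h2 : z + Pi.single ν (1 : ZMod L) - Pi.single ν 1 = z := by abel
    have h3 : z + (Pi.single μ (1 : ZMod L) + Pi.single ν 1) - Pi.single ν 1 =
        z + Pi.single μ 1 := by abel
    have h4 : z + Pi.single μ (1 : ZMod L) - Pi.single μ 1 = z := by abel
    simp only [add_zero, Matrix.sub_mulVec, Pi.sub_apply, ← Matrix.mulVec_mulVec,
      conjTranspose_linkHop_mulVec, h1, h2, h3, h4]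

end Helpers

/-! ### The printed statement -/

/-- **Hernández–Jansen–Lüscher 1999, App. C (C.5)–(C.6): the commutators of the covariant
differences are bounded by the plaquette deviation.**  For a unitary representation `ρ`, a periodic
lattice `(ℤ/Lℤ)⁴` (`L ≥ 1`), a gauge field with `‖1 − ρ(U(p))‖ ≤ ε` for all plaquettes `p`, and
`μ ≠ ν`: `‖[∇_μ,∇_ν]‖ ≤ ε`, `‖[∇_μ,∇*_ν]‖ ≤ ε`, `‖[∇*_μ,∇*_ν]‖ ≤ ε` — here as the quadratic-form
bounds `Σ_i ‖(Kφ)_i‖² ≤ ε² Σ_i ‖φ_i‖²` for `K = F_μF_ν − F_νF_μ`, `F_μF_νᴴ − F_νᴴF_μ`,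
`F_μᴴF_νᴴ − F_νᴴF_μᴴ`, `F_μ = linkHop ρ U μ = 1 + ∇_μ`, `F_μᴴ = 1 − ∇*_μ` (lattice units).
[cite: HernandezJansenLuscher1999, App. C (C.5)–(C.6)] -/
theorem hjl_commutator_bounds :
    ∀ {L N : ℕ} [NeZero L] {G : Type*} [Group G] (ρ : G →* Matrix (Fin N) (Fin N) ℂ),
      (∀ g, ρ g ∈ Matrix.unitaryGroup (Fin N) ℂ) → ∀ (U : GaugeConfig 4 L G) (ε : ℝ),
      IsNormAdmissible ρ U ε →
      ∀ μ ν : Fin 4, μ ≠ ν → ∀ φ : TorusSite 4 L × Fin N → ℂ,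
        (∑ i, ‖((linkHop ρ U μ * linkHop ρ U ν - linkHop ρ U ν * linkHop ρ U μ) *ᵥ φ) i‖ ^ 2 ≤
            ε ^ 2 * ∑ i, ‖φ i‖ ^ 2) ∧
        (∑ i, ‖((linkHop ρ U μ * (linkHop ρ U ν)ᴴ - (linkHop ρ U ν)ᴴ * linkHop ρ U μ) *ᵥ φ) i‖ ^ 2 ≤
            ε ^ 2 * ∑ i, ‖φ i‖ ^ 2) ∧
        (∑ i, ‖(((linkHop ρ U μ)ᴴ * (linkHop ρ U ν)ᴴ - (linkHop ρ U ν)ᴴ * (linkHop ρ U μ)ᴴ) *ᵥ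
              φ) i‖ ^ 2 ≤
            ε ^ 2 * ∑ i, ‖φ i‖ ^ 2) :=
  fun ρ hρ _ _ hU _ _ hμν φ =>
    ⟨sum_norm_sq_linkHop_comm_mulVec_le ρ hρ hU hμν φ,
      sum_norm_sq_linkHop_comm_conjTranspose_mulVec_le ρ hρ hU hμν φ,
      sum_norm_sq_conjTranspose_linkHop_comm_mulVec_le ρ hρ hU hμν φ⟩

end Literature.MathematicalPhysics.QuantumLattice
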